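import Literature.AlgebraicGeometry.HodgeTheory.RealHodgeTypeSubspaces
import HarnessLib

/-!
# Hodge–Riemann with sign on the real blocks `(P^{s,t} ⊕ P^{t,s})_ℝ` of the middle cohomology

For `X` smooth projective of EVEN dimension `n = 2m`, a Kähler–rational datum `D` (Kähler class
`H_η`, volume class `Ω = y_Ω ⊗ 1`) and a PRIMITIVE class `σ ∈ H^{2m}(X(ℂ); ℂ)` of Hodge type `(s, t)`,
`s + t = 2m` (primitive in the middle degree: `H_η ⌣ σ = 0`), Voisin I Thm. 6.32 reads, with its sign
made explicit (`i^{s-t} (-1)^{2m(2m-1)/2} = (-1)^s`, `voisinSign_middle_eq`):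

* `KaehlerRationalDatum.cupProduct_conjClass_middle_primitive`: `σ ⌣ σ̄ = (-1)^s t · Ω` with `t > 0`;
* `KaehlerRationalDatum.cupProduct_reClass_middle_primitive` (`s ≠ t`): for the real and imaginary parts,
  `(re σ)² = (im σ)² = (-1)^s c · y_Ω`, `re σ ⌣ im σ = 0`, with `c ≥ 0` and `c > 0` for `σ ≠ 0` — i.e. the
  real cup pairing is DEFINITE of sign `(-1)^s ε` on the real block spanned by `re σ, im σ`
  (`σ ⌣ σ = 0` by type, `cupProduct_eq_zero_of_types_middle`; "the sign of `H` on `L^r H^{a,b}_prim` is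
  equal to `(-1)^a`", proof of Thm. 6.33, case `r = 0`).

The surface case `(s, t) = (2, 0)` is `KaehlerRationalDatum.cupProduct_reClass_twoZero`
(`HodgeIndexSurfaceSigned.lean`); these are the per-block inputs of the signature theorem in
dimension `2m` (successor of `Voisin2002_hodgeIndex_hodgeRiemann_middle_one`).

## References

* C. Voisin, *Hodge Theory and Complex Algebraic Geometry I* (2002), §6.3.2 Thm. 6.32 and the proof
  of Thm. 6.33, PDF p. 129 of the held text. [cite: VoisinHodgeI2002, §6.3.2 Thms. 6.32–6.33]
-/

noncomputable section

open scoped Manifold ContDiff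
open CategoryTheory AlgebraicGeometry Module Bundle
open Literature.AlgebraicTopology.SingularHomology Literature.Geometry.Kaehler
open Literature.NumberTheory.Transcendental
open Literature.AlgebraicGeometry.Motives (IsSmoothProjective kaehlerFormPow)

namespace Literature.AlgebraicGeometry.HodgeTheory

section MiddleBlocks

variable {m : ℕ} {X : Motives.SchemeOver ℂ}

/-- **The Hodge–Riemann sign in the middle degree**: `i^{s-t} (-1)^{2m(2m-1)/2} = (-1)^s` for
`s + t = 2m`. [cite: VoisinHodgeI2002, §6.3.2 Thm. 6.32 and proof of Thm. 6.33] -/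
theorem voisinSign_middle_eq {s t : ℕ} (hst : s + t = 2 * m) :
    Complex.I ^ ((s : ℤ) - t) * (-1 : ℂ) ^ (2 * m * (2 * m - 1) / 2) = (-1 : ℂ) ^ s := by
  have h1 : 2 * m * (2 * m - 1) / 2 = m * (2 * m - 1) := by
    rw [Nat.mul_assoc, Nat.mul_div_cancel_left _ two_pos]
  have h2 : ((s : ℤ) - t) = 2 * ((s : ℤ) - m) := by omega
  rw [h1, h2, zpow_mul, zpow_ofNat, Complex.I_sq]
  -- parities
  have hm : (-1 : ℂ) ^ (m * (2 * m - 1)) = (-1 : ℂ) ^ m := by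
    rcases Nat.even_or_odd m with hm | hm
    · rw [hm.neg_one_pow, (hm.mul_right _).neg_one_pow]
    · have hodd : Odd (m * (2 * m - 1)) := by
        refine hm.mul ?_
        obtain ⟨j, rfl⟩ := hm
        exact ⟨2 * j, by omega⟩
      rw [hm.neg_one_pow, hodd.neg_one_pow]
  rw [hm]
  rcases Nat.even_or_odd s with hs | hs <;> rcases Nat.even_or_odd m with hm' | hm'
  · have hz : Even ((s : ℤ) - m) := by
      obtain ⟨a, ha⟩ := hs; obtain ⟨b, hb⟩ := hm'; exact ⟨(a : ℤ) - b, by omega⟩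
    rw [hz.neg_one_zpow, hs.neg_one_pow, hm'.neg_one_pow, one_mul]
  · have hz : Odd ((s : ℤ) - m) := by
      obtain ⟨a, ha⟩ := hs; obtain ⟨b, hb⟩ := hm'; exact ⟨(a : ℤ) - b - 1, by omega⟩
    rw [hz.neg_one_zpow, hs.neg_one_pow, hm'.neg_one_pow]; ring
  · have hz : Odd ((s : ℤ) - m) := by
      obtain ⟨a, ha⟩ := hs; obtain ⟨b, hb⟩ := hm'; exact ⟨(a : ℤ) - b, by omega⟩
    rw [hz.neg_one_zpow, hs.neg_one_pow, hm'.neg_one_pow]; ring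
  · have hz : Even ((s : ℤ) - m) := by
      obtain ⟨a, ha⟩ := hs; obtain ⟨b, hb⟩ := hm'; exact ⟨(a : ℤ) - b, by omega⟩
    rw [hz.neg_one_zpow, hs.neg_one_pow, hm'.neg_one_pow]; ring

namespace KaehlerRationalDatum

variable (D : KaehlerRationalDatum (2 * m) X)

/-- **Hodge–Riemann for primitive middle-degree classes, with sign** (Voisin I Thm. 6.32 at
`k = n = 2m`): for `σ ∈ H^{2m}(X(ℂ); ℂ)` non-zero of type `(s, t)`, `s + t = 2m`, primitive
(`H_η ⌣ σ = 0`), `σ ⌣ σ̄ = (-1)^s t' · Ω` with `t' > 0`. [cite: VoisinHodgeI2002, §6.3.2 Thm. 6.32] -/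
theorem cupProduct_conjClass_middle_primitive (hX : IsSmoothProjective (2 * m) X) {s t : ℕ}
    (hst : s + t = 2 * m) {σ : complexBetti X (2 * m)} (hσ : IsOfHodgeType (2 * m) X (2 * m) s t σ)
    (hσ0 : σ ≠ 0) {h2 : 2 + 2 * m = 2 * m + 2} (hprim : cupProduct h2 D.Hη σ = 0)
    (hdeg : 2 * m + 2 * m = 2 * (2 * m)) :
    ∃ t' : ℝ, 0 < t' ∧
      cupProduct hdeg σ (conjClass (Motives.ComplexPoints X) (2 * m) σ) =
        ((-1 : ℂ) ^ s * (t' : ℂ)) • D.topClass := by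
  have hprim' : lefschetzPow D.Hη (0 + 1) (2 * m) σ = 0 := by
    rw [lefschetzPow_succ, LinearMap.comp_apply, lefschetzPow_zero, LinearMap.id_apply,
      lefschetzOperator_apply]
    exact hprim
  obtain ⟨t', ht', heq⟩ := D.hodgeRiemann_X hX (a := 2 * m) (s := s) (t' := t) (r₀ := 0) rfl
    (by ring) hσ hσ0 hprim'
  rw [lefschetzPow_zero, LinearMap.id_apply, voisinSign_middle_eq hst] at heq
  refine ⟨t', ht', ?_⟩
  -- `(-1)^s • (σ ⌣ σ̄) = t' Ω` ⇒ `σ ⌣ σ̄ = (-1)^s t' Ω`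
  have hinv : ((-1 : ℂ) ^ s) * ((-1 : ℂ) ^ s) = 1 := by
    rw [← pow_add, ← two_mul, pow_mul, neg_one_sq, one_pow]
  have key : cupProduct hdeg σ (conjClass (Motives.ComplexPoints X) (2 * m) σ) =
      ((-1 : ℂ) ^ s) • (((-1 : ℂ) ^ s) • cupProduct hdeg σ (conjClass (Motives.ComplexPoints X) (2 * m) σ)) := by
    rw [smul_smul, hinv, one_smul]
  rw [key]
  have heq' : ((-1 : ℂ) ^ s) • cupProduct hdeg σ (conjClass (Motives.ComplexPoints X) (2 * m) σ) =
      (t' : ℂ) • D.topClass := heq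
  rw [heq', smul_smul]

/-- Expansion of a cup product of complex classes in real and imaginary parts. [folklore] -/
private theorem cupProduct_expand' {Y : Type} [TopologicalSpace Y] {p q k : ℕ} (h : p + q = k)
    (s t : ℂ) (a b : singularCohomology ℝ ℝ Y q) (c d : singularCohomology ℝ ℝ Y p) :
    cupProduct h (ofRealClass Y p c + t • ofRealClass Y p d) (ofRealClass Y q a + s • ofRealClass Y q b) =
      (ofRealClass Y k (cupProduct h c a) + s • ofRealClass Y k (cupProduct h c b)) +
        t • (ofRealClass Y k (cupProduct h d a) + s • ofRealClass Y k (cupProduct h d b)) := by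
  rw [LinearMap.map_add₂, LinearMap.map_smul₂, map_add, map_smul, map_add, map_smul,
    ofRealClass_cupProduct, ofRealClass_cupProduct, ofRealClass_cupProduct, ofRealClass_cupProduct]

/-- **The real block of a primitive `(s, t)`-class, `s ≠ t`, is definite of sign `(-1)^s`**: for
`σ ∈ H^{2m}(X(ℂ); ℂ)` of type `(s,t)`, `s + t = 2m`, `s ≠ t`, with `H_η ⌣ σ = 0`:
`(re σ)² = (im σ)² = (-1)^s c · y_Ω` and `re σ ⌣ im σ = 0` in `H^{4m}(X(ℂ); ℝ)`, with `c ≥ 0`, and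
`c > 0` for `σ ≠ 0` — from `σ ⌣ σ̄ = (-1)^s t' Ω` and `σ ⌣ σ = 0` (type `(2s, 2t) ≠ (2m, 2m)`), read in
real and imaginary parts ("the sign of `H` on `L^r H^{a,b}_prim` is equal to `(-1)^a`", Voisin I,
proof of Thm. 6.33, `r = 0`). [cite: VoisinHodgeI2002, §6.3.2 Thm. 6.32 and proof of Thm. 6.33] -/
theorem cupProduct_reClass_middle_primitive (hX : IsSmoothProjective (2 * m) X) {s t : ℕ}
    (hst : s + t = 2 * m) (hne : s ≠ t) {σ : complexBetti X (2 * m)}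
    (hσ : IsOfHodgeType (2 * m) X (2 * m) s t σ) {h2 : 2 + 2 * m = 2 * m + 2}
    (hprim : cupProduct h2 D.Hη σ = 0) (hdeg : 2 * m + 2 * m = 2 * (2 * m)) :
    ∃ c : ℝ, 0 ≤ c ∧ (σ ≠ 0 → 0 < c) ∧
      cupProduct hdeg (reClass _ (2 * m) σ) (reClass _ (2 * m) σ) =
        ((-1 : ℝ) ^ s * c) • reClass _ (2 * (2 * m)) D.topClass ∧
      cupProduct hdeg (imClass _ (2 * m) σ) (imClass _ (2 * m) σ) =
        ((-1 : ℝ) ^ s * c) • reClass _ (2 * (2 * m)) D.topClass ∧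
      cupProduct hdeg (reClass _ (2 * m) σ) (imClass _ (2 * m) σ) = 0 := by
  set ρ₁ := reClass (Motives.ComplexPoints X) (2 * m) σ with hρ₁
  set ρ₂ := imClass (Motives.ComplexPoints X) (2 * m) σ with hρ₂
  set yΩ := reClass (Motives.ComplexPoints X) (2 * (2 * m)) D.topClass with hyΩ
  have hσsplit : σ = ofRealClass _ (2 * m) ρ₁ + Complex.I • ofRealClass _ (2 * m) ρ₂ :=
    (ofRealClass_reClass_add_I_smul σ).symm
  have hσconj : conjClass _ (2 * m) σ = ofRealClass _ (2 * m) ρ₁ - Complex.I • ofRealClass _ (2 * m) ρ₂ :=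
    conjClass_eq_reClass_sub_imClass σ
  have hΩreal : ofRealClass _ (2 * (2 * m)) yΩ = D.topClass :=
    ofRealClass_reClass_of_conjClass_eq D.conjClass_topClass
  -- graded commutativity in the even degree `2m`
  have hcomm : cupProduct hdeg ρ₂ ρ₁ = cupProduct hdeg ρ₁ ρ₂ := by
    rw [cupProduct_gradedComm_holds ℝ (Motives.ComplexPoints X) hdeg hdeg ρ₂ ρ₁]
    have heven : Even (2 * m * (2 * m)) := ⟨2 * m * m, by ring⟩
    rw [heven.neg_one_pow, one_smul]
  -- `σ ⌣ σ = 0` (type `(2s, 2t) ≠ (2m, 2m)` since `s ≠ t`)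
  have h0 : cupProduct hdeg σ σ = 0 :=
    cupProduct_eq_zero_of_types_middle hX hσ hσ hst hst
      (fun e ↦ hne ((congrArg Prod.fst e).trans rfl)) hdeg
  rw [hσsplit, cupProduct_expand'] at h0
  have h0' : ofRealClass _ (2 * (2 * m)) (cupProduct hdeg ρ₁ ρ₁ - cupProduct hdeg ρ₂ ρ₂) +
      Complex.I • ofRealClass _ (2 * (2 * m)) (cupProduct hdeg ρ₁ ρ₂ + cupProduct hdeg ρ₂ ρ₁) =
      ofRealClass _ (2 * (2 * m)) 0 + Complex.I • ofRealClass _ (2 * (2 * m)) 0 := by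
    rw [map_zero, smul_zero, add_zero, ← h0]
    simp only [map_sub, map_add, smul_add, smul_smul, Complex.I_mul_I, neg_one_smul]
    abel
  obtain ⟨hre0, him0⟩ := ofRealClass_add_I_smul_inj h0'
  have h12 : cupProduct hdeg ρ₁ ρ₂ = 0 := by
    rw [hcomm, ← two_smul ℝ] at him0
    exact (smul_eq_zero.1 him0).resolve_left two_ne_zero
  have e1 : cupProduct hdeg ρ₁ ρ₁ = cupProduct hdeg ρ₂ ρ₂ := sub_eq_zero.1 hre0
  by_cases hσ0 : σ = 0
  · refine ⟨0, le_rfl, fun h ↦ (h hσ0).elim, ?_, ?_, h12⟩ <;>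
      simp [hρ₁, hρ₂, hσ0, map_zero]
  -- `σ ⌣ σ̄ = (-1)^s t' Ω`: real parts give `ρ₁² + ρ₂² = (-1)^s t' yΩ`
  obtain ⟨t', ht', hEq⟩ := D.cupProduct_conjClass_middle_primitive hX hst hσ hσ0 hprim hdeg
  rw [hσconj, sub_eq_add_neg, ← neg_smul, hσsplit, cupProduct_expand', ← hΩreal,
    show ((-1 : ℂ) ^ s * (t' : ℂ)) = (((-1 : ℝ) ^ s * t' : ℝ) : ℂ) by push_cast; ring,
    ← ofRealClass_smul] at hEq
  have hsum : cupProduct hdeg ρ₁ ρ₁ + cupProduct hdeg ρ₂ ρ₂ = ((-1 : ℝ) ^ s * t') • yΩ := by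
    have h1 := congrArg (reClass (Motives.ComplexPoints X) (2 * (2 * m))) hEq
    simpa [neg_smul, reClass_I_smul, imClass_I_smul] using h1
  have h11 : cupProduct hdeg ρ₁ ρ₁ = ((-1 : ℝ) ^ s * (t' / 2)) • yΩ := by
    have e2 : (2 : ℝ) • cupProduct hdeg ρ₁ ρ₁ = ((-1 : ℝ) ^ s * t') • yΩ := by rw [two_smul, ← hsum, e1]
    have : cupProduct hdeg ρ₁ ρ₁ = (1 / 2 : ℝ) • ((2 : ℝ) • cupProduct hdeg ρ₁ ρ₁) := by
      rw [smul_smul]; norm_num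
    rw [this, e2, smul_smul]
    congr 1
    ring
  refine ⟨t' / 2, by positivity, fun _ ↦ by positivity, h11, ?_, h12⟩
  rw [← e1, h11]

end KaehlerRationalDatum

end MiddleBlocks

end Literature.AlgebraicGeometry.HodgeTheory

end
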